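import Summits.QuantumFields.QCD.Theses.NestedDissectionSea
import Summits.QuantumFields.QCD.Theses.HeavyThresholdYMBridge
import Summits.QuantumFields.QCD.Theses.AdaptiveBlockFermions
import Literature.MathematicalPhysics.QuantumFieldTheory.QuasiLocalGaugePerturbationKernels
import Literature.MathematicalPhysics.QuantumFieldTheory.QuasiLocalGaugePerturbationBlockLeak
import Literature.Probability.LatticeModels.CoarseCellFiniteSize
import Literature.Probability.LatticeModels.CoarseCellMixingDefectsBlockLeak
import Literature.Probability.LatticeModels.CoarseCellMixingPeierls
import Literature.Probability.LatticeModels.CoarseCellMixingDefectsAnnealed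
import Summits.QuantumFields.QCD.Theorems.NestedDissectionSeaRobustYangMillsLocalAC
import Summits.QuantumFields.QCD.Theorems.NestedDissectionSeaRobustYangMillsStubDeployment
import Summits.QuantumFields.QCD.Theorems.NestedDissectionSeaRobustYangMillsStubDeploymentUKP
import Summits.QuantumFields.QCD.Theorems.NestedDissectionSeaRobustYangMillsStubEngineOfAnnealed

/- r5 SKELETON (continuation lead c6, 2026-08-16T21Z). Canonical form: `work/RobustYangMills.lean` in the lead's folder, which
IMPORTS `Summits.QuantumFields.QCD.Theorems.NestedDissectionSeaRobustYangMillsStubDeploymentDressed` (reshape r5: the dressed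
engine `DressedGaugeEngine d`, `DeploymentDressed`, the CLOSED `stub_deploymentDressed`, `dressedGaugeEngine_zero`; proposed this
seat). Until that module is accepted AND built on the farm it is INLINED verbatim between the markers `BEGIN/END inlined
StubDeploymentDressed` below; everything after `END` is the skeleton proper (5 open registered stubs: `stub_dressedEngine`,
`stub_wilsonCertificate`, `stub_renormalisedLeg`, `stub_coincidentResponse`, `stub_uvRider`; `stub_deploymentDressed`,
`stub_localAC`, `stub_diagonalFragment` are landed/closed theorems used by name in `RobustYangMills_of`). The r4/r4′ engine
vocabulary (`AnnealedEngineBQL`, `PerturbedMixingEngineBQL`, `DeploymentBQL`, `stub_engineOfAnnealedBQL`) stays in the tree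
module `…EngineBQL` (p117358) and is no longer on the composition path. -/

-- ===== BEGIN inlined StubDeploymentDressed (proposed tree module Theorems/NestedDissectionSeaRobustYangMillsStubDeploymentDressed.lean) =====
/-!
# Line `local-ac-open-certificate` for the crux `RobustYangMills` (stmt-QuantumFields-13897) —
# reshape r5: the DRESSED engine (polymer currency) and the CLOSED stub `stub_deploymentDressed`

Crux: `Summit.QuantumFields.QCD.Theses.NestedDissectionSea.RobustYangMills` (shared verbatim with
`HeavyThresholdYMBridge` / `AdaptiveBlockFermions`); checked skeleton
`Cruxes/RobustYangMills/Lines/local_ac_open_certificate.lean`; companion modules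
`NestedDissectionSeaRobustYangMillsLocalAC` (§0–§1: `spec`, `wilsonSpec`, `LocalACToolkit`,
`stub_localAC`), `NestedDissectionSeaRobustYangMillsStubDeployment{,UKP}` (`WilsonGoodCertificateUKP`,
`IRConeClustering`, `level_numerics`, `final_numeric`, `level_bound`, `stub_deploymentUKP`) and
`NestedDissectionSeaRobustYangMillsEngineBQL` (reshape r4: the ABSTRACT quasi-local engine
`AnnealedEngineBQL` over `HasBlockLeak`, `PerturbedMixingEngineBQL`, `DeploymentBQL`).

**Why r5 (continuation lead c6, 2026-08-16).** The one registered stub of this line that is provable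
mathematics and survives the restatement of clause (iv) is the engine. Leads c2/c3 showed that its
abstract r4 form `AnnealedEngineBQL` (one specification, block quasi-locality `HasBlockLeak cell γ a r`,
`0 < a ≤ a₀`) is not reachable by any sup-norm / total-variation form of the Dobrushin–Shlosman block
recursion ((E) multi-cell influence with defects is exponential in the support, (P) a leak forces
supports polynomial in the distance; `Lines/local-ac-open-certificate-c2-engine.md`), and lead c4's
only surviving architecture (Variant C, `Lines/local-ac-open-certificate-c4-variantC.md`: exact
Bernoulli decoupling `e^{-W_X} = (1-p_X) + p_X g_X` of the far polymers, the landed `a = 0` induction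
run in the JOINT system with active polymers as a second Peierls species) proves NOT the abstract
kernel-level statement but the measure-level, polymer-currency statement typed by lead c3 as
`DressedGaugeEngine d` (`Lines/local_ac_open_certificate_engine_variants.lean`, Variant B; c4 trap 5).
This module therefore carries the r5 vocabulary:

* `DressedGaugeEngine d` — Variant B with two corrections: (1) the reference finite-size condition is
  taken at `2ε·shellCount d n ≤ 1`, exactly as `WilsonGoodCertificateUKP` delivers it (and as
  `PerturbedMixingEngineBQL` takes it), so that the near-dressing of the reference kernels (local a.c.
  at rate `O(η₀)`, `isGoodFS_of_isLocallyAC`) has finite-size room `1/(4·shellCount d n)` with a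
  threshold `η₀ = η₀(n)` chosen BEFORE `ε` — at `ε·shellCount = 3/4` (Variant B as typed) no dressing
  room is left for the contraction of the landed engine; (2) the DLR data of the reference and of the
  dressed kernels (`IsSpecification`, `IsGibbsMeasure … (W.perturbedMeasure ρ β)`) are explicit
  hypotheses, supplied by toolkit (c) `KernelDLR` in the deployment, so that the engine is a statement
  of classical probability about the given kernels. Statement of the OPEN stub `stub_dressedEngine`
  (item-sized: to be promoted);
* `DeploymentDressed` — toolkit + dressed engine + UKP-certificate ⇒ uniform IR clustering of the
  translation-invariant sup-small range-controlled cone for every `κ ≥ κ₀` (the engine's rate threshold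
  at the certificate's window), statement of the CLOSED stub `stub_deploymentDressed`, PROVED here:
  the frames / level numerics of the landed `stub_deploymentUKP`, the engine called directly on the
  cone member `w` (its kernels ARE `w.kernel ρ₃ β = spec ρ₃ β w`, Wilson's are
  `(0 : …).kernel ρ₃ β = wilsonSpec ρ₃ β`, both by `rfl`), blocks-per-cell `K = 10⁴`
  (`card_image_blockCorner_le_mul_cellCount`), block-to-cell nearness
  (`cdist_cellOf_le_of_blockCorner_near`), budget `η₁ := η₀/10⁴`, and the one-level species bound with
  the engine factor `e^{|Δf|}` (`level_bound_exp`, landed in `…WilsonSlice`; re-proved privately here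
  while that module is unbuilt on the farm). Output: `c₁ = c₁(p₀(n))`, `κ₀ = κ₀(n)`, `η₁ = η₀(n)/10⁴`,
  `Δ = κₑ/(6ℓ₀)`;
* `dressedGaugeEngine_zero` — NON-VACUITY / the `W = 0` slice in every dimension `d`: the body of
  `DressedGaugeEngine d` at `W = 0` follows from the PROVED block-Markov engine
  `Literature.Probability.LatticeModels.annealed_influence_markov_defects` (Wilson's kernels are
  block-Markov through cells, `hasBlockLeak_kernel_zero`) in covariance form.

Sources: van den Berg–Maes, Ann. Probab. 22 (1994) §2; Dobrushin–Shlosman (1985) §2 and J. Stat.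
Phys. 46 (1987); Georgii (2011) §8.2, Rem. 1.24; Bertini–Cirillo–Olivieri, CMP 258 (2005);
Olivieri–Picco, JSP 59 (1990); Osterwalder–Seiler, Ann. Phys. 110 (1978) §2.
-/

set_option autoImplicit false

noncomputable section

namespace Summit.QuantumFields.QCD.Cruxes.RobustYangMills.LocalAcOpenCertificate

open scoped BigOperators Topology ENNReal
open Filter MeasureTheory
open Literature.MathematicalPhysics.QuantumLattice Literature.MathematicalPhysics.AQFT
  Literature.MathematicalPhysics.QuantumFieldTheory
open Literature.Probability.LatticeModels (CoarseIdx cdist shellCount cellCount IsGoodFS HasBlockLeak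
  UniformKernelPeierls IsTorusFrame isTorusFrame_axisFrame Specification IsSpecification IsGibbsMeasure
  abs_covariance_le_integral_abs integral_abs_kernel_sub_rescale)

/-! ## §2‴ Reshape r5: the dressed engine (statement of the OPEN stub `stub_dressedEngine`) -/

/-- **The dressed gauge engine** (polymer currency; statement of the OPEN, item-sized stub
`stub_dressedEngine`; `d`-dimensional tori, any compact second-countable gauge group, any
finite-dimensional continuous representation): for every window `n ≥ 1` there are thresholds
`p₀, η₀, κ₀ > 0` and, for every finite-size threshold `ε ≥ 0` with `2ε·shellCount d n ≤ 1`, a rate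
`κₑ > 0` and a constant `C₀ ≥ 0` such that: whenever the cells (`≥ 4n+3` per axis) meet at most `K`
blocks per cell and contract block nearness, Wilson's kernels at coupling `β` and the dressed kernels
are specifications with `μ_{β,W}` Gibbs for the latter, Wilson's kernels satisfy the good-exterior
finite-size condition `(n, ε)` and the kernel-uniform Peierls bound at level `p ≤ p₀` for some
cell-local good sets, and the dressing `W` (block scale `b ≥ 1`) has `‖W‖_{b,κ} ≤ η` with `κ ≥ κ₀`,
`η·K ≤ η₀` and range control (h4), then `μ_{β,W}` has covariance decay
`|⟨fg⟩ − ⟨f⟩⟨g⟩| ≤ C₀ B_f B_g e^{|Δf|} |Δg| e^{−κₑ D}` for bounded measurable cell-local `f, g` at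
coarse distance `≥ D`. Its `W = 0` slice is `dressedGaugeEngine_zero` (proved); for `W ≠ 0` it is
disagreement percolation / a graded cluster expansion with Peierls-rare configuration defects and
KP-small polymer activities (van den Berg–Maes 1994; Dobrushin–Shlosman 1985/1987;
Bertini–Cirillo–Olivieri 2005) — not a textbook theorem in this form. -/
def DressedGaugeEngine (d : ℕ) : Prop :=
  ∀ n : ℕ, 1 ≤ n → ∃ p₀ η₀ κ₀ : ℝ, 0 < p₀ ∧ 0 < η₀ ∧ 0 < κ₀ ∧
    ∀ ε : ℝ, 0 ≤ ε → 2 * ε * (shellCount d n : ℝ) ≤ 1 →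
    ∃ κₑ C₀ : ℝ, 0 < κₑ ∧ 0 ≤ C₀ ∧
    ∀ (G : Type) [Group G] [TopologicalSpace G] [IsTopologicalGroup G] [CompactSpace G]
      [MeasurableSpace G] [BorelSpace G] [SecondCountableTopology G] [MeasurableSingletonClass G]
      (Nρ : ℕ) (ρ : G →* Matrix (Fin Nρ) (Fin Nρ) ℂ), Continuous ρ →
    ∀ (N : ℕ) [NeZero N] (b : ℕ) (μc : Fin d → ℕ) (cell : Edge d N → CoarseIdx μc) (K : ℝ)
      (good : CoarseIdx μc → Set (GaugeConfig d N G)) (β κ η p : ℝ)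
      (W : QuasiLocalGaugePerturbation d N G b),
      1 ≤ b → (∀ i, 4 * n + 3 ≤ μc i + 1) → 0 ≤ K →
      (∀ A : Finset (Edge d N),
        ((A.image fun e => blockCorner b e.1).card : ℝ) ≤ K * cellCount cell A) →
      (∀ (D : ℕ) (e e' : Edge d N),
        (∀ i, (blockCorner b e'.1 i - blockCorner b e.1 i).val ≤ b * (2 * D + 1) ∨
          (blockCorner b e.1 i - blockCorner b e'.1 i).val ≤ b * (2 * D + 1)) →
        cdist (cell e') (cell e) ≤ D + 1) →
      IsSpecification ((0 : QuasiLocalGaugePerturbation d N G 1).kernel ρ β) →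
      IsSpecification (W.kernel ρ β) → IsGibbsMeasure (W.kernel ρ β) (W.perturbedMeasure ρ β) →
      IsGoodFS cell ((0 : QuasiLocalGaugePerturbation d N G 1).kernel ρ β) good n ε →
      0 ≤ p → p ≤ p₀ →
      UniformKernelPeierls cell ((0 : QuasiLocalGaugePerturbation d N G 1).kernel ρ β) good p →
      κ₀ ≤ κ → W.NormLE κ η → η * K ≤ η₀ →
      (∀ X : Finset (Site d N), X ∈ polymers b → (∃ U : GaugeConfig d N G, W.act X U ≠ 0) →
        ∀ y ∈ X, ∀ y' ∈ X, ∀ i : Fin d,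
          (y i - y' i).val ≤ b * X.card ∨ (y' i - y i).val ≤ b * X.card) →
      ∀ (f g : GaugeConfig d N G → ℝ) (Δf Δg : Finset (CoarseIdx μc)) (Bf Bg : ℝ) (D : ℕ),
        Measurable f → Measurable g → (∀ U, |f U| ≤ Bf) → (∀ U, |g U| ≤ Bg) →
        DependsOn f {e | cell e ∈ Δf} → DependsOn g {e | cell e ∈ Δg} →
        (∀ x ∈ Δf, ∀ y ∈ Δg, D ≤ cdist x y) →
          |∫ U, f U * g U ∂(W.perturbedMeasure ρ β) -
              (∫ U, f U ∂(W.perturbedMeasure ρ β)) * ∫ U, g U ∂(W.perturbedMeasure ρ β)| ≤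
            C₀ * Bf * Bg * Real.exp (Δf.card) * Δg.card * Real.exp (-(κₑ * D))

/-- **Deployment of the dressed engine** (reshape r5; statement of the CLOSED stub
`stub_deploymentDressed`): toolkit + dressed engine + UKP-certificate give uniform IR clustering of
the translation-invariant sup-small range-controlled cone for every decay rate `κ ≥ κ₀` (the
engine's threshold at the certificate's window), with a budget `η₁ > 0` and the certificate's scale
`c₁`. -/
def DeploymentDressed : Prop :=
  LocalACToolkit → DressedGaugeEngine 4 → WilsonGoodCertificateUKP →
    ∃ c₁ : ℝ, 0 < c₁ ∧ ∃ κ₀ : ℝ, 0 < κ₀ ∧ ∀ κ : ℝ, κ₀ ≤ κ →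
      ∃ η₁ : ℝ, 0 < η₁ ∧ IRConeClustering η₁ κ c₁

/-! ## Proof of `stub_deploymentDressed` -/

section Proof

/-- One level of the deployment with the engine factor `e^{|Δf|}` (a private copy of the landed
`level_bound_exp` of `…WilsonSlice`, kept here while that module is unbuilt on the farm): a
covariance bound `C₀ B_f B_g e^{|Δf|} |Δg| e^{-κₑ D}` for cell-local observables under `ν` on the
torus `2S+1` gives, for two species read through the periodic lift and the time shift `t ≤ S`, the
bound `C₀ C_A C_B e^{|supp A|} |supp B| e^{κₑ(δ₀+2)} e^{-(κₑ/6ℓ₀) a t}`. -/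
private theorem level_bound_exp_r5 {S b' μ : ℕ} {κₑ C₀ a ℓ₀ : ℝ} (hb' : 0 < b')
    (h2 : 2 * S + 1 < μ * b' + 2 * b')
    (hκₑ : 0 < κₑ) (hC₀ : 0 ≤ C₀) (hℓ₀ : 0 < ℓ₀) (h6 : (2 * b' : ℝ) * a ≤ 6 * ℓ₀)
    (ν : Measure (GaugeConfig 4 (2 * S + 1) SU3))
    (hcov : ∀ (f g : GaugeConfig 4 (2 * S + 1) SU3 → ℝ)
      (Δf Δg : Finset (CoarseIdx (fun _ : Fin 4 => μ))) (Bf Bg : ℝ) (D : ℕ),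
      Measurable f → Measurable g → (∀ σ, |f σ| ≤ Bf) → (∀ σ, |g σ| ≤ Bg) →
      DependsOn f {v | cellOf (prodFrame (2 * S + 1) b' μ) v ∈ Δf} →
      DependsOn g {v | cellOf (prodFrame (2 * S + 1) b' μ) v ∈ Δg} →
      (∀ x ∈ Δf, ∀ y ∈ Δg, D ≤ cdist x y) →
        |∫ σ, f σ * g σ ∂ν - (∫ σ, f σ ∂ν) * ∫ σ, g σ ∂ν| ≤
          C₀ * Bf * Bg * Real.exp (Δf.card) * Δg.card * Real.exp (-(κₑ * D)))
    (A B : YMSpecies SU3) {Ca Cb : ℝ} (hCa : ∀ U, |A.F U| ≤ Ca) (hCb : ∀ U, |B.F U| ≤ Cb) {t : ℕ}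
    (ht : t ≤ S) :
    |∫ U, A.F (torusLift (2 * S + 1) U) *
          B.F (configShift (-Pi.single 0 (t : ℤ)) (torusLift (2 * S + 1) U)) ∂ν -
        (∫ U, A.F (torusLift (2 * S + 1) U) ∂ν) *
          ∫ U, B.F (configShift (-Pi.single 0 (t : ℤ)) (torusLift (2 * S + 1) U)) ∂ν| ≤
      C₀ * Ca * Cb * Real.exp (A.supp.card) * B.supp.card *
        Real.exp (κₑ * (((A.supp.sup fun e => (e.1 0).natAbs) +
          (B.supp.sup fun e => (e.1 0).natAbs) + 2 : ℕ) : ℝ)) *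
        Real.exp (-(κₑ / (6 * ℓ₀) * (a * t))) := by
  have hf : Measurable fun U : GaugeConfig 4 (2 * S + 1) SU3 => A.F (torusLift (2 * S + 1) U) :=
    A.measurable.comp (measurable_torusLift _)
  have hg : Measurable fun U : GaugeConfig 4 (2 * S + 1) SU3 =>
      B.F (configShift (-Pi.single (0 : Fin 4) (t : ℤ)) (torusLift (2 * S + 1) U)) :=
    B.measurable.comp ((configShift _).measurable.comp (measurable_torusLift _))
  have hmain := hcov _ _ _ _ Ca Cb _ hf hg (fun U => hCa _) (fun U => hCb _)
    (dependsOn_comp_torusLift A.isCylinder _)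
    (dependsOn_comp_configShift_torusLift B.isCylinder _ _)
    (le_cdist_cellOf_torusEdge_timeShift hb' h2 A.supp B.supp ht)
  refine hmain.trans ?_
  have hCa0 : 0 ≤ Ca := (abs_nonneg _).trans (hCa fun _ => 1)
  have hCb0 : 0 ≤ Cb := (abs_nonneg _).trans (hCb fun _ => 1)
  have hΔf : Real.exp ((A.supp.image fun e => cellOf (prodFrame (2 * S + 1) b' μ)
      (torusEdge (2 * S + 1) e)).card : ℝ) ≤ Real.exp (A.supp.card : ℝ) :=
    Real.exp_le_exp.2 (by exact_mod_cast Finset.card_image_le)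
  have hΔg : ((B.supp.image fun e => cellOf (prodFrame (2 * S + 1) b' μ)
      (torusEdge (2 * S + 1) (e.1 - -Pi.single (0 : Fin 4) (t : ℤ), e.2))).card : ℝ) ≤
      B.supp.card := by
    exact_mod_cast Finset.card_image_le
  have hnum := final_numeric (t := t)
    (δ₀ := (A.supp.sup fun e => (e.1 0).natAbs) + (B.supp.sup fun e => (e.1 0).natAbs))
    (a := a) hκₑ hℓ₀ hb' h6
  have hK : 0 ≤ C₀ * Ca * Cb := by positivity
  generalize (A.supp.image fun e => cellOf (prodFrame (2 * S + 1) b' μ)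
      (torusEdge (2 * S + 1) e)).card = cf at *
  generalize (B.supp.image fun e => cellOf (prodFrame (2 * S + 1) b' μ)
      (torusEdge (2 * S + 1) (e.1 - -Pi.single (0 : Fin 4) (t : ℤ), e.2))).card = cg at *
  generalize t / (2 * b') -
    ((A.supp.sup fun e => (e.1 0).natAbs) + (B.supp.sup fun e => (e.1 0).natAbs) + 1) = D at *
  have hprod := mul_le_mul hΔf hΔg (Nat.cast_nonneg _) (Real.exp_pos _).le
  have hE : 0 ≤ Real.exp (-(κₑ * D)) := (Real.exp_pos _).le
  calc C₀ * Ca * Cb * Real.exp (cf : ℝ) * cg * Real.exp (-(κₑ * D))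
      = (C₀ * Ca * Cb) * (Real.exp (cf : ℝ) * cg) * Real.exp (-(κₑ * D)) := by ring
    _ ≤ (C₀ * Ca * Cb) * (Real.exp (A.supp.card : ℝ) * B.supp.card) * Real.exp (-(κₑ * D)) :=
        mul_le_mul_of_nonneg_right (mul_le_mul_of_nonneg_left hprod hK) hE
    _ ≤ (C₀ * Ca * Cb) * (Real.exp (A.supp.card : ℝ) * B.supp.card) *
        (Real.exp (κₑ * (((A.supp.sup fun e => (e.1 0).natAbs) +
          (B.supp.sup fun e => (e.1 0).natAbs) + 2 : ℕ) : ℝ)) *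
          Real.exp (-(κₑ / (6 * ℓ₀) * (a * t)))) :=
        mul_le_mul_of_nonneg_left hnum (by positivity)
    _ = _ := by ring

/-- **`stub_deploymentDressed` (CLOSED)**: toolkit + dressed engine + UKP-certificate give uniform IR
clustering of the translation-invariant sup-small range-controlled cone for every `κ ≥ κ₀(n)`.
Constants: the certificate's window `n`; the engine's thresholds `(p₀, η₀, κ₀)` at `n`; the
certificate's `(ε₀, c₁)` at rarity `p₀` (`2ε₀·shellCount ≤ 1`); the engine's `(κₑ, C₀)` at `ε₀`;
budget `η₁ := η₀/10⁴` (blocks per cell `K = 10⁴`); `Δ = κₑ/(6ℓ₀)`; frames of scale `⌈2ℓ₀/a_k⌉`. In the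
IR regime `Λ'ℓ₀ ≥ c₁`, eventually in `k`, on the torus `2S+1 ≥ 2L_k+1` the engine is called on the
cone member `w` itself (its kernels are `spec ρ₃ β w`, Wilson's are `wilsonSpec ρ₃ β`, DLR by toolkit
(c)); (h1) turns D1's `connectedCorr` into the covariance (`connectedCorr_eq_covCorr`). -/
theorem stub_deploymentDressed : DeploymentDressed := by
  rintro ⟨-, -, hDLR⟩ hE ⟨n, hn, hcert⟩
  obtain ⟨p₀, η₀, κ₀, hp₀, hη₀, hκ₀, heng⟩ := hE n hn
  obtain ⟨ε₀, c₁, hε₀, hshell, hc₁, hcert⟩ := hcert p₀ hp₀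
  obtain ⟨κₑ, C₀, hκₑ, hC₀, hEng⟩ := heng ε₀ hε₀ hshell
  refine ⟨c₁, hc₁, κ₀, hκ₀, fun κ hκ => ⟨η₀ / 10 ^ 4, by positivity, ?_⟩⟩
  intro a L ha ha₀ haL β' Λ' hΛ' hβ ℓ₀ hℓ₀
  have hℓ₀pos : 0 < ℓ₀ := pos_of_mul_pos_right (hc₁.trans_le hℓ₀) hΛ'.le
  refine ⟨κₑ / (6 * ℓ₀), by positivity, fun A B => ?_⟩
  obtain ⟨Ca, hCa⟩ := A.bounded
  obtain ⟨Cb, hCb⟩ := B.bounded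
  refine ⟨C₀ * Ca * Cb * Real.exp (A.supp.card) * B.supp.card *
    Real.exp (κₑ * (((A.supp.sup fun e => (e.1 0).natAbs) +
      (B.supp.sup fun e => (e.1 0).natAbs) + 2 : ℕ) : ℝ)), ?_⟩
  have hev1 : ∀ᶠ k in atTop, a k ≤ min 1 ℓ₀ := ha₀.eventually_le_const (lt_min one_pos hℓ₀pos)
  have hev2 : ∀ᶠ k in atTop, (4 * (n : ℝ) + 3) * (2 * ℓ₀ + 1) ≤ a k * L k :=
    haL.eventually_ge_atTop _
  have hev3 := hcert a ha ha₀ β' Λ' hΛ' hβ (2 * (Λ' * ℓ₀)) (by linarith)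
  filter_upwards [hev1, hev2, hev3] with k hk1 hk2 hk3
  intro S hS w hw hrc hinv t ht
  obtain ⟨hb, hb', hbb, h2b, h1, h2, hμ, h6⟩ := level_numerics (n := n) (ha k)
    (hk1.trans (min_le_left _ _)) (hk1.trans (min_le_right _ _)) hk2 hS
  set b' := ⌈2 * ℓ₀ / a k⌉₊ with hb'def
  set μ := (2 * S + 1) / b' - 1 with hμdef
  have hCeq : ⌈2 * (Λ' * ℓ₀) / (Λ' * a k)⌉₊ = b' := by
    rw [hb'def]; congr 1; field_simp
  obtain ⟨good, hFS, -, hUKP⟩ := hk3 S (fun _ => μ) (prodFrame (2 * S + 1) b' μ) (fun _ => hμ)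
    (fun _ => by rw [hCeq]; exact isTorusFrame_axisFrame hb' h1 h2)
  -- DLR inputs (toolkit (c)): the dressed kernels `spec ρ₃ β w = w.kernel ρ₃ β` and Wilson's
  have hρ : Continuous ρ₃ := continuous_fundamentalRep _
  obtain ⟨hspw, hgw⟩ := hDLR SU3 3 ρ₃ hρ (2 * S + 1) _ (β' k) w
  obtain ⟨hsp0, -⟩ := hDLR SU3 3 ρ₃ hρ (2 * S + 1) 1 (β' k) 0
  -- blocks per cell and block-to-cell nearness for the product frames
  have hK : ∀ A : Finset (Edge 4 (2 * S + 1)),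
      ((A.image fun e => blockCorner ⌊ℓ₀ / a k⌋₊ e.1).card : ℝ) ≤
        10 ^ 4 * cellCount (cellOf (prodFrame (2 * S + 1) b' μ)) A := fun A => by
    exact_mod_cast card_image_blockCorner_le_mul_cellCount (μ := μ) hb hb' hbb h2 A
  have hcon := cdist_cellOf_le_of_blockCorner_near (d := 4) (μ := μ) hb hb' h2b h1
  have hηK : η₀ / 10 ^ 4 * 10 ^ 4 ≤ η₀ := (div_mul_cancel₀ η₀ (by norm_num : (10 : ℝ) ^ 4 ≠ 0)).le
  -- the dressed engine at this level, for the covariance; (h1) turns `connectedCorr` into it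
  rw [w.connectedCorr_eq_covCorr ρ₃ (β' k) hinv, w.covCorr_eq_integral]
  exact level_bound_exp_r5 hb' h2 hκₑ hC₀ hℓ₀pos h6 _
    (hEng SU3 3 ρ₃ hρ (2 * S + 1) ⌊ℓ₀ / a k⌋₊ (fun _ => μ) (cellOf (prodFrame (2 * S + 1) b' μ))
      (10 ^ 4) good (β' k) κ (η₀ / 10 ^ 4) p₀ w hb (fun _ => hμ) (by norm_num) hK hcon hsp0 hspw
      hgw hFS hp₀.le le_rfl hUKP hκ hw hηK hrc)
    A B hCa hCb ht

end Proof

/-! ## Non-vacuity: the `W = 0` slice of the dressed engine, in every dimension -/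

/-- **The `W = 0` slice of the dressed engine (every dimension `d`)**: at `W = 0` the body of
`DressedGaugeEngine d` holds, with thresholds `p₀ = q₀(d, n)` of the block-Markov engine, any
`η₀, κ₀ > 0`, and constants `(κₑ, 2C)`: Wilson's kernels are block-Markov through the cells
(`hasBlockLeak_kernel_zero`), the PROVED engine
`Literature.Probability.LatticeModels.annealed_influence_markov_defects` bounds the averaged boundary
influence of `[0,1]`-valued cell-local observables by `C e^{|Δf|} |Δg| e^{-κₑ D}`, and the DLR
covariance bound (`abs_covariance_le_integral_abs`) with the affine rescaling of `f`
(`integral_abs_kernel_sub_rescale`) turns it into covariance decay under the (Gibbs) measure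
`μ_{β,0}`. This is the content of the landed `…WilsonSlice` size theorem, in the engine's own
quantifier shape. -/
theorem dressedGaugeEngine_zero (d n : ℕ) :
    ∃ p₀ : ℝ, 0 < p₀ ∧ ∀ ε : ℝ, 0 ≤ ε → 2 * ε * (shellCount d n : ℝ) ≤ 1 →
    ∃ κₑ C₀ : ℝ, 0 < κₑ ∧ 0 ≤ C₀ ∧
    ∀ (G : Type) [Group G] [TopologicalSpace G] [IsTopologicalGroup G] [CompactSpace G]
      [MeasurableSpace G] [BorelSpace G] [SecondCountableTopology G] [MeasurableSingletonClass G]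
      (Nρ : ℕ) (ρ : G →* Matrix (Fin Nρ) (Fin Nρ) ℂ), Continuous ρ →
    ∀ (N : ℕ) [NeZero N] (b : ℕ) (μc : Fin d → ℕ) (cell : Edge d N → CoarseIdx μc) (K : ℝ)
      (good : CoarseIdx μc → Set (GaugeConfig d N G)) (β p : ℝ),
      1 ≤ b → (∀ i, 4 * n + 3 ≤ μc i + 1) →
      (∀ A : Finset (Edge d N),
        ((A.image fun e => blockCorner b e.1).card : ℝ) ≤ K * cellCount cell A) →
      (∀ (D : ℕ) (e e' : Edge d N),
        (∀ i, (blockCorner b e'.1 i - blockCorner b e.1 i).val ≤ b * (2 * D + 1) ∨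
          (blockCorner b e.1 i - blockCorner b e'.1 i).val ≤ b * (2 * D + 1)) →
        cdist (cell e') (cell e) ≤ D + 1) →
      IsSpecification ((0 : QuasiLocalGaugePerturbation d N G 1).kernel ρ β) →
      IsGibbsMeasure ((0 : QuasiLocalGaugePerturbation d N G 1).kernel ρ β)
        ((0 : QuasiLocalGaugePerturbation d N G 1).perturbedMeasure ρ β) →
      IsGoodFS cell ((0 : QuasiLocalGaugePerturbation d N G 1).kernel ρ β) good n ε →
      0 ≤ p → p ≤ p₀ →
      UniformKernelPeierls cell ((0 : QuasiLocalGaugePerturbation d N G 1).kernel ρ β) good p →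
      ∀ (f g : GaugeConfig d N G → ℝ) (Δf Δg : Finset (CoarseIdx μc)) (Bf Bg : ℝ) (D : ℕ),
        Measurable f → Measurable g → (∀ U, |f U| ≤ Bf) → (∀ U, |g U| ≤ Bg) →
        DependsOn f {e | cell e ∈ Δf} → DependsOn g {e | cell e ∈ Δg} →
        (∀ x ∈ Δf, ∀ y ∈ Δg, D ≤ cdist x y) →
          |∫ U, f U * g U ∂((0 : QuasiLocalGaugePerturbation d N G 1).perturbedMeasure ρ β) -
              (∫ U, f U ∂((0 : QuasiLocalGaugePerturbation d N G 1).perturbedMeasure ρ β)) *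
                ∫ U, g U ∂((0 : QuasiLocalGaugePerturbation d N G 1).perturbedMeasure ρ β)| ≤
            C₀ * Bf * Bg * Real.exp (Δf.card) * Δg.card * Real.exp (-(κₑ * D)) := by
  obtain ⟨q₀, κₑ, C, hq₀, hκₑ, hC, hEng⟩ :=
    Literature.Probability.LatticeModels.annealed_influence_markov_defects.{0, 0} d n
  refine ⟨q₀, hq₀, fun ε hε hshell => ⟨κₑ, 2 * C, hκₑ, by positivity, ?_⟩⟩
  intro G _ _ _ _ _ _ _ _ Nρ ρ hρ N _ b μc cell K good β p hb hμc hK hcon hsp0 hg0 hFS hp hpp₀ hUKP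
    f g Δf Δg Bf Bg D hf hg hfB hgB hfdep hgdep hD
  have hshell' : ε * (shellCount d n : ℝ) ≤ 3 / 4 := by
    have := (shellCount d n).cast_nonneg (α := ℝ)
    nlinarith
  have hBL : HasBlockLeak cell ((0 : QuasiLocalGaugePerturbation d N G 1).kernel ρ β) 0 1 :=
    QuasiLocalGaugePerturbation.hasBlockLeak_kernel_zero ρ hρ hb _ hK hcon β zero_le_one
  haveI := hg0.isProbabilityMeasure
  set ν := (0 : QuasiLocalGaugePerturbation d N G 1).perturbedMeasure ρ β with hν
  have hcore := hEng cell _ good ν ε p 1 hμc hsp0 hg0 hε hshell' hFS hBL hp hpp₀ hUKP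
  -- covariance ≤ averaged boundary influence, rescaled (as in `abs_covariance_le_of_annealed_influence`)
  set Λ : Finset (Edge d N) := Finset.univ.filter fun v => cell v ∉ Δg with hΛ
  have hgdep' : DependsOn g ((↑Λ : Set (Edge d N))ᶜ) := by
    refine fun σ τ hστ => hgdep fun v hv => hστ v ?_
    intro hvΛ
    exact (Finset.mem_filter.1 (Finset.mem_coe.1 hvΛ)).2 hv
  obtain ⟨σ₀⟩ : Nonempty (GaugeConfig d N G) := by
    obtain ⟨σ, -⟩ := nonempty_of_measure_ne_zero (μ := ν) (s := Set.univ) (by simp)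
    exact ⟨σ⟩
  have hBf : 0 ≤ Bf := (abs_nonneg _).trans (hfB σ₀)
  have hBg : 0 ≤ Bg := (abs_nonneg _).trans (hgB σ₀)
  have hcov := abs_covariance_le_integral_abs hsp0 hg0 Λ hf hg hfB hgB hgdep'
  have hRHS : 0 ≤ 2 * C * Bf * Bg * Real.exp (Δf.card) * Δg.card * Real.exp (-(κₑ * D)) := by
    positivity
  rcases hBf.eq_or_lt with hBf0 | hBfpos
  · have hf0 : ∀ σ, f σ = 0 := fun σ => abs_nonpos_iff.1 (hBf0 ▸ hfB σ)
    have : ∫ σ, f σ * g σ ∂ν - (∫ σ, f σ ∂ν) * ∫ σ, g σ ∂ν = 0 := by simp [hf0]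
    rw [this, abs_zero]
    exact hRHS
  · set f' : GaugeConfig d N G → ℝ := fun σ => (f σ / Bf + 1) / 2 with hf'
    have hf'm : Measurable f' := ((hf.div_const Bf).add_const 1).div_const 2
    have hf'01 : ∀ σ, 0 ≤ f' σ ∧ f' σ ≤ 1 := fun σ => by
      have h := hfB σ
      rw [abs_le] at h
      have hlo : -1 ≤ f σ / Bf := by rw [le_div_iff₀ hBfpos]; linarith [h.1]
      have hhi : f σ / Bf ≤ 1 := by rw [div_le_iff₀ hBfpos]; linarith [h.2]
      simp only [hf']
      constructor <;> linarith
    have hf'dep : DependsOn f' {v | cell v ∈ Δf} := fun σ τ hστ => by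
      simp only [hf', hfdep hστ]
    have hcore' := hcore f' Δf Δg D hf'm hf'01 hf'dep hD
    have hresc := integral_abs_kernel_sub_rescale hsp0 (ν := ν) Λ hf hfB hBfpos
    calc |∫ σ, f σ * g σ ∂ν - (∫ σ, f σ ∂ν) * ∫ σ, g σ ∂ν|
        ≤ Bg * ∫ ζ, |∫ σ, f σ ∂((0 : QuasiLocalGaugePerturbation d N G 1).kernel ρ β Λ ζ) -
            ∫ σ, f σ ∂ν| ∂ν := hcov
      _ = Bg * (2 * Bf * ∫ ζ, |∫ σ, f' σ ∂((0 : QuasiLocalGaugePerturbation d N G 1).kernel ρ β Λ ζ) -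
            ∫ σ, f' σ ∂ν| ∂ν) := by rw [hresc]
      _ ≤ Bg * (2 * Bf * (C * Real.exp (Δf.card) * Δg.card * Real.exp (-(κₑ * D)))) := by gcongr
      _ = 2 * C * Bf * Bg * Real.exp (Δf.card) * Δg.card * Real.exp (-(κₑ * D)) := by ring

end Summit.QuantumFields.QCD.Cruxes.RobustYangMills.LocalAcOpenCertificate

end


-- ===== END inlined StubDeploymentDressed =====

/-!
# Line `local-ac-open-certificate` — skeleton for the crux `NestedDissectionSea.RobustYangMills`
(item stmt-QuantumFields-13897; shared verbatim by HeavyThresholdYMBridge #2 and AdaptiveBlockFermions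
#4), crux-plan round 1, planner `planner-cruxplan-stmt-QuantumFields-13897-local-ac-open-certif-0`.

**Crux (fixed, by name).** `∃ η₀ > 0, ∃ κ ≥ 0, ∀` scaling data, a.f. `SU(3)` coupling sequences
`(β', Λ')`, block scales `ℓ₀ > 0` and families `W` admissible eventually in `k` ((h1) lattice
symmetries, (h2) RP, (h3) `‖W‖_{⌊ℓ₀/a_k⌋,κ} ≤ η₀/max(1, afBeta 0 Λ' ℓ₀)`, (h4) range control):
subsequential OS limit of all renormalised species with non-trivial non-Gaussian curvature ((i′),(ii)),
`HasMassGap Δ`, uniform lattice clustering (iii′) and Lipschitz continuity in `W` (iv). §0 names its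
pieces (`AdmAt`, `ClauseConv/Cluster/Lip`, `Concl`, `budget`, `Explicit`); `robustYangMills_of_explicit`
is the definitional unfolding.

**Idea (Cruxes/RobustYangMills/Ideas/local-ac-open-certificate.md; triage r1-1 pass (U-half), r1-2
pass, r1-3 pass).** (h3) is a sup bound at a PHYSICAL block scale, so the DLR kernels of `μ_{β',W}` on
`n`-block regions have two-sided, `k`-uniform densities `e^{±2ηn}` w.r.t. Wilson's kernels with the same
exterior (`stub_localAC`, THE LEVER, provable now). IR half: a finite-size mixing certificate for the
Wilson reference is OPEN under such perturbations. PLANNER'S REPAIR of the IR half (answering r1-1's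
kill of the worst-case TV engine, "UV-toxic": coherent exterior flux `θ₀/b` per plaquette has central
Cameron–Martin norm `≍ βθ₀²b² → ∞`): the certificate is asked only for exterior data that are GOOD
(typical) on the cube and its shell, bad cells being Peierls-rare under the MEASURE (`IsGoodFS`,
`PeierlsRare`); the engine becomes disagreement percolation with rare open defects plus a local-a.c.
bootstrap for rarity under the perturbed measure (`stub_mixingEngine`, classical, `G`-blind); the bet is
the `SU(3)` Wilson GOOD-CUBE certificate along every a.f. sequence (`stub_wilsonCertificate`, W-free,
the card's Transfer target `C⁺` in typical-boundary form); `stub_deployment` (frames, counting, `∀ᶠ`)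
turns toolkit + engine + certificate into `IRConeClustering`: clause (iii′) with constants UNIFORM over
the whole (h3)∧(h4)-cone in the infrared regime `Λ'ℓ₀ ≥ c₁`, RP-free and symmetry-free — this line's
own deliverable. The renormalised-field clauses are NOT reachable by sup-norm/TV information (the
`a_k^{-4}` renormalisation; triage r1-2 App. C): they are isolated in `stub_renormalisedLeg` ((i′),
(ii), gap, (iv) on `⁰𝒮`: `W ≡ 0` Clay core — Disproof §5 — + washing of the rigidity lines + E1 + RP
transfer matrix), CONDITIONAL on the uniform clustering this line supplies, and in the SUSPECT shared
node `stub_diagonalExtension` ((iv) on `⁰𝒮` ⇒ verbatim (iv): believed false for coincident smearings,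
`3Δμ·Var ≍ δ g_k² a_k^{-4}` — the same flag as Lines/cross-plane-hankel-rigidity.lean Stub 5; a
restatement of (iv) on `⁰𝒮` makes it trivial); the ultraviolet regime `Λ'ℓ₀ < c₁` is the explicitly
foreign `stub_uvRider` (soft-absorption line). `RobustYangMills_of` composes the seven stubs into the
crux BY NAME (regime split; constants reconciled by monotonicity, §6); `RobustYangMills_proof` (primary `HeavyThresholdYMBridge` name), `_proof_nestedDissectionSea`,
`_proof_adaptiveBlockFermions` are the unconditional forms for the three verbatim route copies.

**Disproof.lean (cdisprove, 01:21Z) honoured.** §4 `robustYangMillsNoSmall_false` ((h3) load-bearing):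
(h3) enters quantitatively at `stub_deployment` (`ε₁ = 2·7⁴·η₁` against the engine's threshold) and in
toolkit (a)/(b). §0b `rangeControl_of_side_le` ((h4) does not localise large polymers): toolkit (b) uses
the weight `e^{κ|X|}` WITH (h4), and the deployment needs `κ > 0` (`r = κ`; the composition takes
`κ = max κ₀ κ₄ ≥ κ₀ > 0` in r5) — this also honours triage r1-2 Appendix A (the `κ = 0` instance of the crux body is
false modulo a specific-heat bound: the `κ = 0` mixture `W^mix` is sup-small yet long-range ordered;
`IRConeClustering η₁ 0 c₁` is never claimed). §5 `robustYangMills_imp_wilson` (crux ⊇ Clay `SU(3)` +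
β-universality): that content sits in `stub_wilsonCertificate` (IR, gap) and `stub_renormalisedLeg`
(UV, OS existence), openly. Landed Negative lemmas `Theorems/RobustYangMills/Negative/{GlobalActivity,
MixtureWitness}` (global one-activity witnesses `gOne/gMix`): their perturbations have sup norm `≍ β S_W`,
outside every `NormLE κ η₁` ball — no stub is an instance they refute. `-- Targets`: none yet.

**Triage answers.** r1-1 (IR half UV-toxic; re-scope to (U)): worst-case condition replaced by the
good-exterior condition + Peierls; the e^{±η}-stability the washing line wants is toolkit (a). r1-2/r1-3
(needs `κ > 0`): built in (`r = κ > 0`). r1-3 (2) ((iv) via `L²`/moment norms, not sup norms):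
recorded in `stub_renormalisedLeg` (washing + BCO expansion; no interpolation in `W`; (iv) on `⁰𝒮`). r1-3 (3) (scope:
consuming routes sit at `ℓ₀ ≪ c₁/Λ'`): `stub_uvRider` is the explicit foreign leg. r1-2/r1-3 merge with
certified-cube-openness: this skeleton IS the merged line (bounded-tilt sandwich + certificate engine).
-/

set_option autoImplicit false

noncomputable section

namespace Summit.QuantumFields.QCD.Cruxes.RobustYangMills.LocalAcOpenCertificate

open scoped BigOperators Topology ENNReal
open Filter MeasureTheory
open Literature.MathematicalPhysics.QuantumLattice Literature.MathematicalPhysics.AQFT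
  Literature.MathematicalPhysics.QuantumFieldTheory
open Summit.QuantumFields.QCD.Theses.NestedDissectionSea (RobustYangMills)

/-! ## §0–§1 The crux's vocabulary and the local-a.c. toolkit: LANDED

`SU3, ρ₃, r₃, Family, AdmAt, sch, ClauseConv, ClauseCluster, ClauseLip, ClauseLipOff, ClauseLipFrag,
ClauseLipCoin, Concl, budget, Explicit, spec, wilsonSpec, RangeControl, NearBlocks, KernelACInW,
KernelQuasiLocality, KernelDLR, LocalACToolkit, DiagonalFragment, CoincidentResponse` and the CLOSED stubs
`stub_localAC`, `stub_diagonalFragment` are the tree module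
`Summits/QuantumFields/QCD/Theorems/NestedDissectionSeaRobustYangMillsLocalAC.lean` (p86951, accepted
2026-08-16T07:0xZ; same namespace), imported above. The generic coarse-cell vocabulary `CoarseIdx, cdist,
shellCount, cellCount, IsGoodFS, HasLeak, IsLocallyAC, PeierlsRare` is the Literature module
`Literature/Probability/LatticeModels/CoarseCellFiniteSize.lean` (p87707, accepted), opened below. -/

open Literature.Probability.LatticeModels (CoarseIdx cdist shellCount cellCount IsGoodFS HasLeak HasBlockLeak
  IsLocallyAC PeierlsRare IsTorusFrame UniformKernelPeierls Specification IsSpecification IsGibbsMeasure)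

/-- The named form is the crux (definitional unfolding). -/
theorem robustYangMills_of_explicit {η₀ κ : ℝ} (hη₀ : 0 < η₀) (hκ : 0 ≤ κ) (h : Explicit η₀ κ) :
    RobustYangMills := by
  refine ⟨η₀, hη₀, κ, hκ, ?_⟩
  intro a L ha ha₀ haL β' Λ' hΛ' hβ' ℓ₀ hℓ₀ η hAdm W hW
  exact h a L ha ha₀ haL β' Λ' hΛ' hβ' ℓ₀ hℓ₀ W hW



/-! ## §2–§3 Cells, engine, certificate, IR clustering, deployment: LANDED

`IsTorusFrame` (Literature `ZModTorusFrames`, p89221), `siteCell`, `cellOf` (Literature `BlockCellGeometry`,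
p92943), and the line Props `PerturbedMixingEngine`, `WilsonGoodCertificate`, `IRConeClustering` (reshape r2,
with the (h1) binder), `Deployment` together with the CLOSED stub `stub_deployment` are the tree module
`Summits/QuantumFields/QCD/Theorems/NestedDissectionSeaRobustYangMillsStubDeployment.lean` (p93656, accepted
2026-08-16T09:14Z; wave-2 worker), imported above. -/





/-! ## §2′ RESHAPE r3 (lead, 2026-08-16T13Z): the honest engine and the strengthened certificate

Wave 2's verdict on `stub_mixingEngine : PerturbedMixingEngine` (worker + Literature
`CoarseCellMixing{DLR,Counting,Recursion,Peierls,…}`): the typed engine is NOT derivable from its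
hypotheses — Peierls rarity of bad cells under the reference MEASURE `ν₀` cannot be transferred to the
perturbed `ν` by any volume-local argument (`IsLocallyAC` costs `e^{ε₁·cellCount A}`, `ν₀`-Peierls controls
no kernel with a boundary condition, `IsGoodFS` at `ε₀ ≤ 1/(2sc)` only gives `γ₀(c bad | good shell) ≤ p+ε₀`);
not refuted either (a global free-energy inequality at the edge). The clean certificate-side datum is the
KERNEL-UNIFORM Peierls bound `UniformKernelPeierls cell γ₀ good p` (Literature `CoarseCellMixingPeierls`,
p94577): with it the transfer `ν₀ → ν` is PROVED (`peierlsRare_of_uniformKernelPeierls`) and the engine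
reduces, PROVED (`stub_engineOfAnnealed`, landing), to the one-specification `AnnealedEngine` (classical,
OPEN: disagreement percolation / Dobrushin–Shlosman with Peierls-rare defects and a leak). The defect-free
engine (`good ≡` everything) is proved outright (worker's `perturbedMixingEngineDF`) but needs the worst-case
certificate that triage r1-1 killed. Hence r3: `stub_mixingEngine` ↦ `stub_annealedEngine` (open) +
`stub_engineOfAnnealed` (proved); `stub_wilsonCertificate` is STRENGTHENED by the conjunct
`UniformKernelPeierls (cellOf q) (wilsonSpec …) good p` (YM-plausible: coherent-flux cells are rare
uniformly in the boundary condition away from boundary defects); `stub_deployment` (landed p93656 for the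
old shapes, now unused) ↦ `stub_deploymentUKP` (same proof threading the extra datum; landing). -/

/-! ### r3 vocabulary: LANDED
`PerturbedMixingEngineUKP`, `AnnealedEngine` and the CLOSED stub `stub_engineOfAnnealed` are the tree module
`Theorems/NestedDissectionSeaRobustYangMillsStubEngineOfAnnealed.lean` (p105630); `WilsonGoodCertificateUKP`,
`DeploymentUKP` and the CLOSED stub `stub_deploymentUKP` are `Theorems/NestedDissectionSeaRobustYangMillsStubDeploymentUKP.lean`
(p107218); `UniformKernelPeierls` is Literature `CoarseCellMixingPeierls` (p94577). All imported / opened above. -/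

/-! ## §2″ RESHAPE r4 (continuation lead c1, 2026-08-16T17Z): the engine over BLOCK quasi-locality

Wave 3's verdict on `stub_annealedEngine : AnnealedEngine` (r3): MISSTATED for the method — every
hypothesis of `AnnealedEngine` reads only CENTRAL-cell marginals of cube kernels (`HasLeak`, `IsGoodFS`),
so coupling-free recursions stall at a floor `O(q)`; an expansion around the Peierls-rare bad clusters
resamples whole clusters and needs quasi-locality of BLOCK kernels for block-local observables, i.e. the
ratio-form `HasBlockLeak cell γ a r` (Literature `CoarseCellMixingDefectsBlockLeak`, p106636), which the
Yang–Mills kernels satisfy for free (`QuasiLocalGaugePerturbation.hasBlockLeak_kernel_of_card_le`,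
p112333: amplitude `4η₁K`, rate `κ`; Wilson: amplitude `0`). No counterexample to the r3 TEXT is known;
it is simply not what the line can prove or needs. Hence r4 (the r3 Props stay in the tree, unused):

* `stub_annealedEngine` ↦ `stub_annealedEngineBQL : AnnealedEngineBQL` (OPEN; quasi-local form,
  `a ≤ a₀(n, r)`); its block-Markov instance `AnnealedEngineBQLMarkov` (`a = 0`, van den Berg–Maes through
  cells) is being PROVED in the Literature series `CoarseCellMixingDefects…` and lands as a `--supports`
  lemma — it is the honest classical core of the line's IR mechanism; the step `a = 0 ↦ a ≤ a₀` is where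
  the r4 engine is open (lead's analysis: truncating a quasi-local block observable at range `t` exposes
  `(2t)^d` cells whose bad clusters cost `(1+O(q))^{(2t)^d}` against the gain `e^{-rt}` — the defect
  expansion needs per-cell (disagreement-path) resolution there; see the Lines card addendum);
* `stub_engineOfAnnealed` ↦ `stub_engineOfAnnealedBQL : AnnealedEngineBQL → PerturbedMixingEngineBQL`
  (to be CLOSED: the r3 proof with `HasLeak` binders replaced by `HasBlockLeak`);
* `stub_deploymentUKP` ↦ `stub_deploymentBQL : DeploymentBQL` (to be CLOSED: the landed deployment with
  `hasBlockLeak_kernel_of_card_le` / `hasBlockLeak_kernel_zero`, engine run at leak rate `1 ≤ κ`, budget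
  `η₁` also below `a₀/(4·10⁴)`; stated for `κ ≥ 1`, which is all the composition uses).

The r4 vocabulary (`HasBlockLeak.of_le`, `AnnealedEngineBQL`, `AnnealedEngineBQLMarkov`,
`annealedEngineBQLMarkov_of_BQL`, `PerturbedMixingEngineBQL`, `DeploymentBQL`) and the CLOSED stub
`stub_engineOfAnnealedBQL` are the tree module `Theorems/NestedDissectionSeaRobustYangMillsEngineBQL.lean`
(p117358, accepted 2026-08-16T17:38Z); `stub_deploymentBQL` is proved in the proposed module
`…StubDeploymentBQL` (p119606, lead c1). Neither is on the r5 composition path (next section). -/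


/-! ## §2‴ RESHAPE r5 (continuation lead c6, 2026-08-16T21Z): the DRESSED engine replaces the abstract one

Leads c2/c3's verdict on `stub_annealedEngineBQL : AnnealedEngineBQL` (r4, `0 < a ≤ a₀`): true-looking but
ITEM-SIZED and, worse for a promotion, the WRONG statement — the abstract kernel-level interface
(`HasBlockLeak cell γ a r` for one specification) is unreachable by every sup-norm / TV form of the block
recursion ((E)+(P), `Lines/local-ac-open-certificate-c2-engine.md` §1) and hides the polymer activity
variables that the one surviving architecture (lead c4's Variant C, `…-c4-variantC.md`: exact Bernoulli
decoupling of the far polymers, the landed `a = 0` induction in the joint system with active polymers as a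
second Peierls species; trap checked by c5 §4) manipulates (c4 trap 5). Hence r5:

* `stub_annealedEngineBQL` ↦ `stub_dressedEngine : DressedGaugeEngine 4` (OPEN, item-sized, TO BE PROMOTED;
  lead c3's Variant B in polymer currency with the finite-size input at `2ε·shellCount ≤ 1` — room for the
  near-dressing — and explicit DLR hypotheses; its `W = 0` slice `dressedGaugeEngine_zero` is PROVED in
  every dimension from `annealed_influence_markov_defects`);
* `stub_deploymentBQL` ↦ `stub_deploymentDressed : DeploymentDressed` (CLOSED this seat: the engine is called
  on the cone member `w` itself — its kernels are `spec ρ₃ β w`, Wilson's are `wilsonSpec ρ₃ β` — with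
  `K = 10⁴` blocks per cell, budget `η₁ = η₀/10⁴`, rates `κ ≥ κ₀(n)`; composition constant `κ := max κ₀ κ₄`).

The r5 vocabulary and both theorems are the (proposed) tree module
`Theorems/NestedDissectionSeaRobustYangMillsStubDeploymentDressed.lean`, inlined above until it is built on
the farm. Registered stubs of r5: `stub_dressedEngine`, `stub_wilsonCertificate`, `stub_renormalisedLeg`,
`stub_coincidentResponse`, `stub_uvRider` (the last four unchanged: three ⊇ stmt-QuantumFields-8796 by the
landed size theorems p123846/p123973/p124005, one the coincident instance of clause (iv), verdict
`misstated`, lead c5, `…-c5-verdict.md`). -/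


/-! ## §4 The renormalised-field leg (stub E), the diagonal extension (stub F, SUSPECT), the
ultraviolet regime (stub G) -/

section Legs

/-- **Renormalised-field leg on `⁰𝒮`** (statement of `stub_renormalisedLeg`; NOT this line's mechanism —
it carries the `W ≡ 0` Clay core (Disproof §5: the crux implies OS existence + gap for pure `SU(3)`
Wilson along every a.f. sequence), the WASHING/rigidity input of the companion lines (admissible `W`
have per-site diluted response, so the `a_k^{-4}`-renormalised species of `μ_{β',W}` are asymptotically
those of Wilson at a shifted a.f. coupling; triage r1-2 App. C, r1-3 on axis-markov-response), FULL
EUCLIDEAN INVARIANCE E1 of the limit (OPEN for cone members; `OSData` bundles E1), the gap transfer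
(odd-torus RP transfer matrix from (h2) + clustering with constants UNIFORM over the cone ⇒ spectral gap
⇒ `HasMassGap` via E0′ — OneCertifiedCube.GapToContinuum, stmt-8896, whose pair-dependent-constant
caveat is answered by the uniformity of `IRConeClustering`) and the Lipschitz response ON `⁰𝒮` (polymer
expansion of `e^{-(W'-W)}`, KP-small by `NormLE κ δ`, around the clustering measure `μ_{β',W}` — BCO-type,
no interpolation in `W` since the RP cone is not star-shaped — plus washing of admissible differences):
given uniform IR clustering of the cone at `(η₁, κ, c₁)` there is a budget `η₂ ≤ η₁` such that every
family admissible with `(κ, η ≤ η₂)` in the IR regime has a subsequential OS limit of all renormalised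
species with non-trivial non-Gaussian curvature ((i′), (ii)), a mass gap, and clause (iv) on `⁰𝒮`. -/
def RenormalisedLeg : Prop :=
  ∀ (η₁ κ c₁ : ℝ), 0 < η₁ → 0 < κ → 0 < c₁ → IRConeClustering η₁ κ c₁ →
    ∃ η₂ : ℝ, 0 < η₂ ∧ η₂ ≤ η₁ ∧
    ∀ (a : ℕ → ℝ) (L : ℕ → ℕ) (ha : ∀ k, 0 < a k) (ha₀ : Tendsto a atTop (𝓝 0))
      (haL : Tendsto (fun k => a k * L k) atTop atTop) (β' : ℕ → ℝ) (Λ' : ℝ), 0 < Λ' →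
      Tendsto (fun k => β' k - afBeta 0 Λ' (a k)) atTop (𝓝 0) →
    ∀ ℓ₀ : ℝ, c₁ ≤ Λ' * ℓ₀ → ∀ η : ℝ, 0 ≤ η → η ≤ η₂ →
    ∀ W : Family a ℓ₀, (∀ᶠ k in atTop, AdmAt κ η a L β' ℓ₀ W k) →
      ∃ φ : ℕ → ℕ, StrictMono φ ∧ ∃ (c m : YMSpecies SU3 → ℕ → ℝ) (T : OSData (YMSpecies SU3) 4),
        ClauseConv a L ha ha₀ haL β' ℓ₀ W φ c m T ∧ T.IsNontrivial r₃.curvature ∧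
          T.IsNonGaussian r₃.curvature ∧ (∃ Δ' : ℝ, 0 < Δ' ∧ T.HasMassGap Δ') ∧
          ClauseLipOff κ η a L ha ha₀ haL β' ℓ₀ W c m

/-- **The ultraviolet regime** (statement of `stub_uvRider`; FOREIGN to this line — it is the crux
restricted to block scales `ℓ₀ < c/Λ'`, for every `c > 0`, i.e. the territory of the rider
(card soft-absorption-balaban-cone: soft conditioning into Bałaban's analytic format and the RG-level
item #2′; triage r1-3 scope line (3)): the `(ℓ/ℓ₀)⁴` wall is real — below `c₁/Λ'` cone members shift
the infrared scale and no bounded-density argument reaches the certificate scale). Stated with its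
own `(η₄, κ₄)`; the composition reconciles the constants by monotonicity. It inherits the (iv) flag. -/
def UVRider : Prop :=
  ∀ c : ℝ, 0 < c → ∃ η₄ : ℝ, 0 < η₄ ∧ ∃ κ₄ : ℝ, 0 ≤ κ₄ ∧
    ∀ (a : ℕ → ℝ) (L : ℕ → ℕ) (ha : ∀ k, 0 < a k) (ha₀ : Tendsto a atTop (𝓝 0))
      (haL : Tendsto (fun k => a k * L k) atTop atTop) (β' : ℕ → ℝ) (Λ' : ℝ), 0 < Λ' →
      Tendsto (fun k => β' k - afBeta 0 Λ' (a k)) atTop (𝓝 0) →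
    ∀ ℓ₀ : ℝ, 0 < ℓ₀ → Λ' * ℓ₀ < c →
    ∀ W : Family a ℓ₀, (∀ᶠ k in atTop, AdmAt κ₄ (budget η₄ Λ' ℓ₀) a L β' ℓ₀ W k) →
      Concl κ₄ (budget η₄ Λ' ℓ₀) a L ha ha₀ haL β' ℓ₀ W

end Legs

/-! ## §5 The registered stubs -/

/-- **stub_dressedEngine** — THE ENGINE, DRESSED FORM (reshape r5; OPEN, item-sized, to be PROMOTED):
covariance decay `C₀ B_f B_g e^{|Δf|} |Δg| e^{-κₑ D}` under `μ_{β,W}` for cell-local bounded observables,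
given Wilson's kernels with the good-exterior finite-size condition (`2ε·shellCount ≤ 1`) and the
kernel-uniform Peierls bound at `p ≤ p₀(n)`, and a dressing `W` with `‖W‖_{b,κ} ≤ η`, `κ ≥ κ₀(n)`,
`η·K ≤ η₀(n)`, range control (h4) — `DressedGaugeEngine 4`. Its `W = 0` slice is PROVED
(`dressedGaugeEngine_zero`, every `d`, from the Literature block-Markov engine
`annealed_influence_markov_defects`); it is implied by the r4 abstract engine (`AnnealedEngineBQL` ⇒
`PerturbedMixingEngineBQL` ⇒ this, through `isLocallyAC_kernel_of_card_le` / `hasBlockLeak_kernel_of_card_le`),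
so it is the WEAKER and the correctly-shaped target. STATUS (leads c2–c6): not reachable by sup-norm / TV
block recursions (c2 §1–§3, §7), nor by a polymer expansion of block kernels (c2 §2); candidate first-order
architecture = Variant C (c4; c5 §4): two-species defect expansion in the joint `(U, n)` system, ≈ 6–7 kLoC
of classical probability reusing the `CoarseCellMixingDefects*` series. Sources: BergMaes1994,
DobrushinShlosman1985, DobrushinShlosman1987, Georgii2011 §8, BertiniCirilloOlivieri2005, OlivieriPicco1990. -/
theorem stub_dressedEngine : DressedGaugeEngine 4 := by
  sorry

/-- **stub_wilsonCertificate** — THE BET (YM-hard, open; W-free; the card's Transfer target `C⁺` in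
good-exterior form = OneCertifiedCube.CrossoverCertificate in ∀-a.f.-sequence, typical-boundary
form + HeavyThreshold #6 `YMLatticeGapAlongAFSequences` in certificate form). Honours Disproof §5
(`robustYangMills_imp_wilson`: the crux contains the pure-Wilson gap along EVERY a.f. sequence — this
stub is where that content enters the IR half) and §4 (`robustYangMillsNoSmall_false`: (h3) is used
quantitatively downstream, in `stub_deployment`, through `ε₁ = 2·7⁴·η₁`). WHY IT MIGHT BE FALSE: (1) no
`k`-uniform good-exterior TV bound exists because even TYPICAL exterior data influence the central
cell's lattice-scale σ-algebra through UV modes (the free-field proxy says no: typical boundary shifts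
have `O(1)·c_n` Cameron–Martin norm, `k`-uniformly — triage r1-2's transfer-matrix heuristic; r1-1's
kit job j009795 tests the WORST case only); (2) the SU(3) Wilson theory along some a.f. sequence is not
in a massive phase at scale `c₁/Λ'` (the crux itself); (3) Peierls-rarity of coherent-flux cells fails
`k`-uniformly (it should improve with `k`: cost `≍ β θ² (ℓ/a_k)²`). Cheapest falsifier: the GFF/compact
`U(1)` toy of the GOOD-exterior influence vs `b` (kit), which must stay bounded as `b → ∞`.
Sources: DobrushinShlosman1985, DobrushinKolafaShlosman1985, Kennedy1993, HallerKennedy1996,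
Balaban1989LargeFieldII, JaffeWitten2000 §5, Luscher1986, arXiv:hep-lat/0204023. -/
theorem stub_wilsonCertificate : WilsonGoodCertificateUKP := by
  sorry

/-- **stub_renormalisedLeg** — the renormalised-field clauses (i′), (ii), gap, (iv) on `⁰𝒮` (YM-hard;
contains the `W ≡ 0` Clay core by Disproof §5, the washing input of the rigidity lines, E1 and the gap
transfer — see `RenormalisedLeg`). Not this line's mechanism; filed so that the skeleton concludes the
crux by name and so that the lead can swap in the companion lines' items (cross-plane-hankel-rigidity:
`YMCore`, `SchwingerWashing`, `OffDiagonalResponse`; OneCertifiedCube `ContinuumLimitExists` /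
`GapToContinuum`; ParabolicTrajectory `ContinuumLimitOnTrajectory`). Local a.c. enters through the
transfer of boundary-GOOD-uniform UV bounds and of conditional-variance / third-cumulant margins from
Wilson (the card's U-half). WHY IT MIGHT FAIL: an admissible, non-washed (CLT-normalised) block functional
would make the `c_k ≍ a_k^{-4}`-renormalised two-point function of `μ_{β',W}` diverge (crux false at
(i′)/(ii)); E1 for hypercubic-but-not-`O(4)` cone members is open. Sources: JaffeWitten2000,
Balaban1988Convergent, Balaban1989LargeFieldII, MagnenRivasseauSeneor1993, OsterwalderSchrader1975,
OsterwalderSeilerAnnPhys1978, GlimmJaffe1987 §6.1/§19, Seiler1982 ch. 2, FriedliVelenik2017 ch. 5,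
doi:10.1007/s10955-006-9214-8. -/
theorem stub_renormalisedLeg : RenormalisedLeg := by
  sorry

/-- **stub_coincidentResponse** — SUSPECT residual of the former `stub_diagonalExtension` (RESHAPE r2):
the coincident instances of clause (iv). Believed FALSE as the crux stands (coincident third moments:
`3Δμ·Var ≍ δ g_k² a_k^{-4}`); disappears once (iv) is restated on `⁰𝒮`. Filed to name the defect, not
to be staffed. Sources: triage r1-2 App. C; Lines/cross-plane-hankel-rigidity.lean §2 Stub 5;
FLAG-clause-iv.md; wave-1 audit work/stubs/DiagonalExtensionAudit.lean. -/
theorem stub_coincidentResponse : CoincidentResponse := by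
  sorry

/-- **stub_uvRider** — the ultraviolet regime `Λ'ℓ₀ < c` (FOREIGN: the crux restricted to small block
scales; delivered, if at all, by the soft-absorption line — card soft-absorption-balaban-cone, its
Transfer `RobustYangMillsRG♭`, ParabolicTrajectory.ParabolicCentreCurve — not by local absolute
continuity; recorded here as the honest second leg of the regime split `ℓ₀ ≷ c₁/Λ'`, triage r1-2/r1-3
scope lines). If that line dies, THIS line covers exactly the IR regime. Sources: Balaban1988Convergent,
Balaban1989LargeFieldII, JaffeWitten2000. -/
theorem stub_uvRider : UVRider := by
  sorry

/-! ### Name-keyed aliases of the five open statements (hypotheses of the composition)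

`Registered.stub_X` is statement `X` under the registered stub's short name, so that the native skeleton
audit (hypotheses admissible iff registered obligations / declared stubs BY NAME) accepts
`RobustYangMills_of : Registered.stub_dressedEngine → … → RobustYangMills`; the closed
`stub_deploymentDressed` (r5), `stub_localAC` and `stub_diagonalFragment` (p86951) are used by name inside
the composition (device of Lines/cross-plane-hankel-rigidity.lean, Cruxes/NoisyFourier/Lines/half-conserved-witness.lean). -/
namespace Registered

/-- Alias of `DressedGaugeEngine 4` keyed by the registered stub name. -/
abbrev stub_dressedEngine : Prop := DressedGaugeEngine 4
/-- Alias of `WilsonGoodCertificateUKP` keyed by the registered stub name. -/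
abbrev stub_wilsonCertificate : Prop := WilsonGoodCertificateUKP
/-- Alias of `RenormalisedLeg` keyed by the registered stub name. -/
abbrev stub_renormalisedLeg : Prop := RenormalisedLeg
/-- Alias of `CoincidentResponse` keyed by the registered stub name. -/
abbrev stub_coincidentResponse : Prop := CoincidentResponse
/-- Alias of `UVRider` keyed by the registered stub name. -/
abbrev stub_uvRider : Prop := UVRider

end Registered

/-! ## §6 Monotonicity of the crux's clauses in `(κ, η, Δ)` -/

section Mono

variable {κ κ' η η' : ℝ} {a : ℕ → ℝ} {L : ℕ → ℕ} {β' : ℕ → ℝ} {ℓ₀ : ℝ}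

theorem budget_nonneg {η₀ Λ' ℓ₀ : ℝ} (h : 0 ≤ η₀) : 0 ≤ budget η₀ Λ' ℓ₀ :=
  div_nonneg h (le_trans zero_le_one (le_max_left _ _))

theorem budget_le {η₀ Λ' ℓ₀ : ℝ} (h : 0 ≤ η₀) : budget η₀ Λ' ℓ₀ ≤ η₀ :=
  div_le_self h (le_max_left _ _)

theorem budget_mono {η₀ η₀' Λ' ℓ₀ : ℝ} (h : η₀ ≤ η₀') : budget η₀ Λ' ℓ₀ ≤ budget η₀' Λ' ℓ₀ :=
  div_le_div_of_nonneg_right h (le_trans zero_le_one (le_max_left _ _))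

/-- Admissibility is antitone in `κ` and monotone in `η` (only (h3) moves). -/
theorem AdmAt.mono {W : Family a ℓ₀} {k : ℕ} (h : AdmAt κ η a L β' ℓ₀ W k) (hκ : κ' ≤ κ)
    (hη : η ≤ η') : AdmAt κ' η' a L β' ℓ₀ W k := fun S hS =>
  ⟨(h S hS).1, (h S hS).2.1, (h S hS).2.2.1, (h S hS).2.2.2.1,
    ((h S hS).2.2.2.2.1.anti hκ).mono hη, (h S hS).2.2.2.2.2⟩

/-- Clause (iv) with a LARGER admissible set of comparison families implies it with a smaller one. -/
theorem ClauseLip.mono {ha : ∀ k, 0 < a k} {ha₀ : Tendsto a atTop (𝓝 0)}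
    {haL : Tendsto (fun k => a k * L k) atTop atTop} {W : Family a ℓ₀}
    {c m : YMSpecies SU3 → ℕ → ℝ} (h : ClauseLip κ' η' a L ha ha₀ haL β' ℓ₀ W c m) (hκ : κ' ≤ κ)
    (hη : η ≤ η') : ClauseLip κ η a L ha ha₀ haL β' ℓ₀ W c m := by
  intro n σ f
  obtain ⟨C, hC⟩ := h n σ f
  refine ⟨C, hC.mono fun k hk W' hW' δ hδ hN => ?_⟩
  exact hk W' (hW'.mono hκ hη) δ hδ fun S hS => (hN S hS).anti hκ

/-- The conclusion is antitone in `κ` and monotone in `η`. -/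
theorem Concl.mono {ha : ∀ k, 0 < a k} {ha₀ : Tendsto a atTop (𝓝 0)}
    {haL : Tendsto (fun k => a k * L k) atTop atTop} {W : Family a ℓ₀}
    (h : Concl κ' η' a L ha ha₀ haL β' ℓ₀ W) (hκ : κ' ≤ κ) (hη : η ≤ η') :
    Concl κ η a L ha ha₀ haL β' ℓ₀ W := by
  obtain ⟨φ, hφ, c, m, T, Δ, hΔ, h1, h2, h3, h4, h5, h6⟩ := h
  exact ⟨φ, hφ, c, m, T, Δ, hΔ, h1, h2, h3, h4, h5, h6.mono hκ hη⟩

/-- Clause (iii′) is antitone in the rate. -/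
theorem ClauseCluster.anti {W : Family a ℓ₀} {Δ Δ' : ℝ} (ha : ∀ k, 0 < a k)
    (h : ClauseCluster a L β' ℓ₀ W Δ) (hΔ : Δ' ≤ Δ) : ClauseCluster a L β' ℓ₀ W Δ' := by
  intro A B
  obtain ⟨C, hC⟩ := h A B
  refine ⟨max C 0, hC.mono fun k hk S hS n hn => (hk S hS n hn).trans ?_⟩
  have hx : 0 ≤ a k * n := mul_nonneg (ha k).le (Nat.cast_nonneg n)
  calc C * Real.exp (-(Δ * (a k * n)))
      ≤ max C 0 * Real.exp (-(Δ * (a k * n))) :=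
        mul_le_mul_of_nonneg_right (le_max_left _ _) (Real.exp_pos _).le
    _ ≤ max C 0 * Real.exp (-(Δ' * (a k * n))) :=
        mul_le_mul_of_nonneg_left (Real.exp_le_exp.2 (by nlinarith)) (le_max_right _ _)

/-- The OS mass gap is antitone in the rate. -/
theorem osData_hasMassGap_anti {ι : Type} {d : ℕ} [NeZero d] (T : OSData ι d) {Δ Δ' : ℝ}
    (hΔ' : Δ' ≤ Δ) (h : T.HasMassGap Δ) : T.HasMassGap Δ' := by
  intro n m k k' F G' hF hG
  obtain ⟨C, hC⟩ := h n m k k' F G' hF hG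
  refine ⟨max C 0, fun t ht H hH => (hC t ht H hH).trans ?_⟩
  calc C * Real.exp (-Δ * t) ≤ max C 0 * Real.exp (-Δ * t) :=
        mul_le_mul_of_nonneg_right (le_max_left _ _) (Real.exp_pos _).le
    _ ≤ max C 0 * Real.exp (-Δ' * t) :=
        mul_le_mul_of_nonneg_left (Real.exp_le_exp.2 (by nlinarith)) (le_max_right _ _)

/-- Clause (iv) is the fragment plus the coincident residual (case split on the guard). -/
theorem clauseLip_of_frag_coin {ha : ∀ k, 0 < a k} {ha₀ : Tendsto a atTop (𝓝 0)}
    {haL : Tendsto (fun k => a k * L k) atTop atTop} {W : Family a ℓ₀}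
    {c m : YMSpecies SU3 → ℕ → ℝ} (hf : ClauseLipFrag κ η a L ha ha₀ haL β' ℓ₀ W c m)
    (hc : ClauseLipCoin κ η a L ha ha₀ haL β' ℓ₀ W c m) : ClauseLip κ η a L ha ha₀ haL β' ℓ₀ W c m := by
  intro n σ f
  by_cases h : (n = 0 ∨ ∃ F : SchwartzMap (Fin n → EuclideanSpace ℝ (Fin 4)) ℂ,
      IsTensorOf F (fun i => ofRealTest (f i)) ∧ IsOffDiagonal F)
  · exact hf n σ f h
  · exact hc n σ f h

end Mono

/-! ## §7 The composition (kernel-checked; no `sorry` outside the five open stubs) -/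

/-- **The line closes the crux BY NAME** (r5). Constants: `(c₁, κ₀)` from the dressed deployment fed by
the toolkit, the dressed engine and the certificate (the certificate's IR scale and the engine's rate
threshold at the certificate's window); `(η₄, κ₄)` from the UV rider at `c = c₁`; `κ := max κ₀ κ₄ > 0`;
`η₁(κ)` from the deployment; `η₂ ≤ η₁` from the renormalised leg; `η₀ := min η₂ η₄`. Given the crux's
data, split on `Λ'ℓ₀ ≷ c₁`. IR: the budget `η = η₀/max(1, afBeta 0 Λ' ℓ₀) ≤ η₀`, so admissibility at
`(κ, η)` feeds the renormalised leg (subsequence, renormalisations, `T`, (i′), (ii), `Δ_T`, (iv) on `⁰𝒮`)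
and — through (h1) ∧ (h3) ∧ (h4) only — the uniform IR clustering (`Δ_L`, (iii′)); the diagonal
fragment (landed) and the coincident residual upgrade (iv); `Δ := min Δ_L Δ_T` by antitonicity. UV:
admissibility at `(κ, η₀)` implies admissibility at `(κ₄, η₄)`, the rider concludes, and the conclusion
is transported back by `Concl.mono`. -/
theorem RobustYangMills_of (hA : Registered.stub_dressedEngine) (hC : Registered.stub_wilsonCertificate)
    (hE : Registered.stub_renormalisedLeg) (hF' : Registered.stub_coincidentResponse)
    (hG : Registered.stub_uvRider) : RobustYangMills := by
  obtain ⟨c₁, hc₁, κ₀, hκ₀, hdep⟩ := stub_deploymentDressed stub_localAC hA hC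
  obtain ⟨η₄, hη₄, κ₄, hκ₄, huv⟩ := hG c₁ hc₁
  have hκpos : (0 : ℝ) < max κ₀ κ₄ := lt_of_lt_of_le hκ₀ (le_max_left _ _)
  have hκ₄le : κ₄ ≤ max κ₀ κ₄ := le_max_right _ _
  obtain ⟨η₁, hη₁, hclu⟩ := hdep (max κ₀ κ₄) (le_max_left _ _)
  obtain ⟨η₂, hη₂, hη₂₁, hleg⟩ := hE η₁ (max κ₀ κ₄) c₁ hη₁ hκpos hc₁ hclu
  have hη₀pos : 0 < min η₂ η₄ := lt_min hη₂ hη₄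
  have h02 : min η₂ η₄ ≤ η₂ := min_le_left _ _
  have h04 : min η₂ η₄ ≤ η₄ := min_le_right _ _
  refine robustYangMills_of_explicit hη₀pos hκpos.le ?_
  intro a L ha ha₀ haL β' Λ' hΛ' hβ' ℓ₀ hℓ₀ W hW
  rcases le_or_gt c₁ (Λ' * ℓ₀) with hIR | hUV
  · -- infrared regime: this line
    have hb0 : 0 ≤ budget (min η₂ η₄) Λ' ℓ₀ := budget_nonneg hη₀pos.le
    have hbη₀ : budget (min η₂ η₄) Λ' ℓ₀ ≤ min η₂ η₄ := budget_le hη₀pos.le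
    obtain ⟨φ, hφ, c, m, T, hconv, hnt, hng, ⟨ΔT, hΔT, hgapT⟩, hlipOff⟩ :=
      hleg a L ha ha₀ haL β' Λ' hΛ' hβ' ℓ₀ hIR _ hb0 (hbη₀.trans h02) W hW
    obtain ⟨ΔL, hΔL, hcl⟩ := hclu a L ha ha₀ haL β' Λ' hΛ' hβ' ℓ₀ hIR
    have hcluster : ClauseCluster a L β' ℓ₀ W ΔL := by
      intro A B
      obtain ⟨C, hCk⟩ := hcl A B
      refine ⟨C, ?_⟩
      filter_upwards [hCk, hW] with k hk hWk S hS t ht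
      have hcone := hWk S hS
      exact hk S hS (W k S) (hcone.2.2.2.2.1.mono (hbη₀.trans (h02.trans hη₂₁)))
        hcone.2.2.2.2.2 hcone.1 t ht
    have hlip : ClauseLip (max κ₀ κ₄) (budget (min η₂ η₄) Λ' ℓ₀) a L ha ha₀ haL β' ℓ₀ W c m :=
      clauseLip_of_frag_coin
        (stub_diagonalFragment _ _ a L ha ha₀ haL β' Λ' hΛ' hβ' ℓ₀ hℓ₀ W hW φ c m T ΔL hφ hconv hnt hΔL
          hcluster hlipOff)
        (hF' _ _ a L ha ha₀ haL β' Λ' hΛ' hβ' ℓ₀ hℓ₀ W hW φ c m T ΔL hφ hconv hnt hΔL hcluster hlipOff)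
    exact ⟨φ, hφ, c, m, T, min ΔL ΔT, lt_min hΔL hΔT, hconv, hnt, hng,
      osData_hasMassGap_anti T (min_le_right _ _) hgapT,
      hcluster.anti ha (min_le_left _ _), hlip⟩
  · -- ultraviolet regime: the rider
    have hW' : ∀ᶠ k in atTop, AdmAt κ₄ (budget η₄ Λ' ℓ₀) a L β' ℓ₀ W k :=
      hW.mono fun k hk => hk.mono hκ₄le (budget_mono h04)
    exact (huv a L ha ha₀ haL β' Λ' hΛ' hβ' ℓ₀ hℓ₀ hUV W hW').mono hκ₄le (budget_mono h04)

/-- **Unconditional form** under the route name of this seat's payload (`NestedDissectionSea`; the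
stubs invoked, `sorry` only inside them). -/
theorem RobustYangMills_proof_nestedDissectionSea : RobustYangMills :=
  RobustYangMills_of stub_dressedEngine stub_wilsonCertificate stub_renormalisedLeg
    stub_coincidentResponse stub_uvRider

/-! ### The shared crux under its other two route names (item stmt-QuantumFields-13897 was filed by
`HeavyThresholdYMBridge`, which the gate treats as primary; the three route copies are verbatim and
definitionally equal, so the same composition serves all three). -/

/-- **The skeleton under the primary name** (the hypothesis-free `<Crux>_proof` the skeleton check
reads; its `sorry`-cone is exactly the five open registered stubs of r5): `HeavyThresholdYMBridge.RobustYangMills`. -/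
theorem RobustYangMills_proof : Summit.QuantumFields.QCD.Theses.HeavyThresholdYMBridge.RobustYangMills :=
  RobustYangMills_of stub_dressedEngine stub_wilsonCertificate stub_renormalisedLeg
    stub_coincidentResponse stub_uvRider

/-- The skeleton under the third name, `AdaptiveBlockFermions.RobustYangMills`. -/
theorem RobustYangMills_proof_adaptiveBlockFermions :
    Summit.QuantumFields.QCD.Theses.AdaptiveBlockFermions.RobustYangMills :=
  RobustYangMills_of stub_dressedEngine stub_wilsonCertificate stub_renormalisedLeg
    stub_coincidentResponse stub_uvRider

/-- Composition concluding the PRIMARY copy `HeavyThresholdYMBridge.RobustYangMills` (sorry-free). -/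
theorem RobustYangMills_of_primary (hA : Registered.stub_dressedEngine)
    (hC : Registered.stub_wilsonCertificate) (hE : Registered.stub_renormalisedLeg)
    (hF' : Registered.stub_coincidentResponse) (hG : Registered.stub_uvRider) :
    Summit.QuantumFields.QCD.Theses.HeavyThresholdYMBridge.RobustYangMills :=
  RobustYangMills_of hA hC hE hF' hG

/-- Composition concluding the copy `AdaptiveBlockFermions.RobustYangMills` (sorry-free). -/
theorem RobustYangMills_of_adaptiveBlockFermions (hA : Registered.stub_dressedEngine)
    (hC : Registered.stub_wilsonCertificate) (hE : Registered.stub_renormalisedLeg)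
    (hF' : Registered.stub_coincidentResponse) (hG : Registered.stub_uvRider) :
    Summit.QuantumFields.QCD.Theses.AdaptiveBlockFermions.RobustYangMills :=
  RobustYangMills_of hA hC hE hF' hG

end Summit.QuantumFields.QCD.Cruxes.RobustYangMills.LocalAcOpenCertificate

end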